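import Literature.MathematicalPhysics.QuantumFieldTheory.Balaban1983to89.B8Thm4FlatTorus
import Literature.MathematicalPhysics.QuantumFieldTheory.Balaban1983to89.B8Prop3Holder
import Literature.MathematicalPhysics.QuantumFieldTheory.Balaban1983to89.B12Ineq331Cutoff

/-!
# `Balaban1983to89.B8Eq136HolderFlatTorus` — T. Bałaban, *Spaces of regular gauge field configurations on a lattice and gauge
# fixing conditions*, Commun. Math. Phys. **99** (1985) 75–102 [Balaban1985RegularSpaces], THE HÖLDER MEMBER of (1.36) / (1.62) /
# Theorem 2 «‖A‖_{1,β} < B₂(β₀)(α₀ + α₁)(Lʲη)^{−2−β}, β ≦ β₀ < 1, on Ω_j», «B₂(β₀) = 5dLB₀(β₀)» (Proposition 3, p. 87) — AT THE FLAT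
# BACKGROUND U₀ = 1, one level (constant domain sequence Ω₀ = … = Ω_k = T_η), on the tori of record — HYPOTHESIS-FREE, from [B5]
# (1.115)'s Hölder entry «‖∇GJ‖_α ≦ O(1)|J|» (rows **B8.Eq1.36**, B8.Prop3, B8.Thm2, B8.Thm4, B8.Eq1.59 cells; heads unchanged)

statement-level skeleton of published theorems with citation tags; proofs where landed; nothing here is a claim about the Yang–Mills mass gap

PDF held: `paper:balaban1985-cmp99-regular-spaces-gauge-fixing` (journal page = PDF page + 74); p. 82 [PDF 8] READ AS AN IMAGE this
session (render `run/shared/lean/pub/pub-balaban/b2b-balaban-ref1/pages/1985-cmp99-regular-spaces-gauge-fixing/…-p008-x2.png`: (1.36));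
pp. 83, 86, 87 [PDF 9, 12, 13] from the text layer (`p0009.txt`, `p0012.txt`, `p0013.txt`); [4] = T. Bałaban, *Propagators for lattice
gauge theories in a background field*, CMP **99** (1985) 389–434 [Balaban1985BackgroundPropagators] p. 397 [PDF 9] text layer ((3.40)–(3.41));
[B5] = T. Bałaban, *Propagators and renormalization transformations for lattice gauge theories. I*, CMP **95** (1984) 17–40
[Balaban1984PropagatorsI] pp. 35–36 [PDF 19–20] text layer ((1.108)–(1.109), (1.115)) and through the tree modules `B5` / `B5Prop12GHolds` /
`B5SettingP12Real` / `B5GlobCoverP12Lattice` / `B5Prop12FieldsLattice` (their verbatim quotations).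

CITATION HEADER (lean-in-tree rule).  Cell `lit-balaban` (HOME `run/shared/lean/pub/lit-balaban/`), unit `lit-balaban-r05` gen 46
(literature-prover-lit-balaban-r05-g46-0; B8 fold owner; free-target protocol G.5-34(d), TAKING line HOME/STATUS 2026-08-22T18:46Z).
SKELETON rows **B8.Eq1.36** ((1.36)–(1.39) pp. 82–83), **B8.Prop3** (p. 87), **B8.Thm2** (p. 83), **B8.Thm4** (p. 88), **B8.Eq1.59**
((1.59) p. 86) — heads «typed-existing» (decls of record `B8.GFData.C136`, `B8.Prop3Printed`, `B8.Thm2Printed`, `B8.Thm4Printed`,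
`B8FromB9.b8_159_transfer` over abstract carriers / the [4] leaf `B9.Thm33Printed`).  THIS MODULE adds the one member of the
printed conclusion list (1.36)–(1.39) that the flat one-level instances of record — `B8Ineq159FlatTorus.prop3_flat` (p320211, r05 g18:
«NOT part of this instance: the Hölder member ‖A‖_{1,β} of (1.62)»), `B8Thm4FlatTorus.thm4_flat`/`thm2_flat` (p320727: «The Hölder member
of (1.36) is not part of the instance») — leave out: **the Hölder member «‖A‖_{1,β} < B₂(β₀)(α₀ + α₁)(Lʲη)^{−2−β}, β ≦ β₀ < 1»**, at
U₀ = 1 on the tori of record, HYPOTHESIS-FREE.  Kind: theorems only (0 `def`, 0 `… : Prop` fact, 0 sorry); every B5/B8 object consumed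
BY NAME; the a-priori algebra of pp. 86–87 for a fifth (1.59)-type quantity is p40's `B8Prop3Holder.apriori_160_fifth` /
`apriori_162_fifth` (p259730 lineage, ℤᵈ carriers modulo the (1.59)-Hölder line) BY NAME.

WHAT IS PRINTED (verbatim).  p. 82 [PDF 8], (1.36): *"U₁ = e^{iηA}, |A| < B₁(α₀ + α₁)(Lʲη)⁻¹, |∇^η_{U₀}A| < B₁(α₀ + α₁)(Lʲη)⁻²,
‖A‖_{1,β} < B₂(β₀)(α₀ + α₁)(Lʲη)^{−2−β}, β ≦ β₀ < 1, on Ω_j, j = 0, 1, …, k, (1.36)"*; p. 83 [PDF 9]: *"Of course we want to prove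
that the constants B₁, B₂(β₀) in (1.36), (1.39) are absolute constants depending on d and L only, B₂(β₀) on β₀ also."*; Theorem 2
p. 83: *"There exist constants B₁, B₂(β₀), c₁ such that for arbitrary U₀, U′U₀ satisfying (1.33)–(1.35) with α₀ + α₁ ≦ c₁ there exists
exactly one gauge transformation u satisfying (1.29) and such that the conditions (1.36)–(1.39) hold for the configuration
U₁ = U′^{u⁻¹}."*; p. 86 [PDF 12]: *"Theorem 3.3 of [4] implies the bounds: |A|₍₋₁₎, |∇^η_{U₀}A|₍₋₂₎, |D^{η*}_{U₀}D^η_{U₀}A|₍₋₃₎,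
|Δ^η_{U₀}A|₍₋₃₎ ≦ B₀(|J|₍₋₃₎ + |B₁|) ≦ … (1.59) Let us take this bound for |∇^η_{U₀}A|₍₋₂₎ on the left-hand side, and let us assume that
B₀36dα₂ ≦ 1/2. … (1.60) Now we assume further that 2α₂² + 20dα₀α₂ + 2C₂α₂² ≦ α₀ + α₁. (1.61)"*; p. 87 [PDF 13]: *"This and the
previous inequality give finally |A| < 5dLB₀(α₀ + α₁)(Lʲη)⁻¹, |∇^η_{U₀}A| < 5dLB₀(α₀ + α₁)(Lʲη)⁻², ‖A‖_{1,β} < 5dLB₀(β)(α₀ + α₁)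
(Lʲη)^{−2−β}, |D^{η*}_{U₀}D^η_{U₀}A|, |Δ^η_{U₀}A| < 5dLB₀(α₀ + α₁)(Lʲη)⁻³ on Ω_j. (1.62) … Proposition 3. If U₀, U₁U₀ satisfy (1.40)–(1.42)
with α₀, α₁, α₂ bounded by a constant depending on d and L only, and α₂ satisfies the additional restriction (1.61), then U₁ satisfies
(1.36)–(1.39) with B₁ = 5dLB₀, B₂(β₀) = 5dLB₀(β₀), where B₀, B₀(β₀) are the corresponding norms of the operators G(U₀), H(U₀), and depend
on d and L only, B₀(β₀) on β₀ also."*; Theorem 4 p. 88: *"… exactly one gauge transformation u … and the configuration U′^{u⁻¹}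
satisfies the conditions (1.36)–(1.39) [(1.67)]"*.  [4] p. 397 [PDF 9], (3.40): *"‖A‖_{1,β} = ‖∇A‖_β = max_{μ,ν} sup_{x,x′:|x−x′|≦1}
|x′ − x|^{−β}|R(U(Γ_{x,x′}))(D_μA_ν)(x′) − (D_μA_ν)(x)|, where Γ_{x,x′} is a shortest contour connecting points x and x′. It is understood
that the η-scale is used in the above definitions."*; (3.41): *"|A|₍α₎ = sup_j sup_{b∈Ω_j} (Lʲη)^{−α}|A(b)|."*  [B5] p. 35 [PDF 19],
(1.109): *"and the Hölder norm ‖A‖_α = max_μ sup_{x,x′:|x−x′|≦1} |x − x′|^{−α}|A_μ(x) − A_μ(x′)|, ‖A‖_{1,α} = ‖∇A‖_α = max_{μ,ν}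
sup_{x,x′:|x−x′|≦1} |x − x′|^{−α}|(∂_μA_ν)(x) − (∂_μA_ν)(x′)|. (1.109)"*; p. 36 [PDF 20], (1.115): *"The localized inequalities (1.110)–(1.114)
imply immediately the following global inequalities |GJ|, |∇GJ|, |G∇*J|, |ΔGJ|, ‖∇GJ‖_α, ‖G∇*J‖_α ≦ O(1)|J|, (1.115)"*, Prop. 1.2
p. 35: *"(1.111) for 0 ≦ α < 1, … with the constant O(1) depending on d and α (O(1) → ∞ if α → 1)"*.

THE INSTANCE (dictionary print ↦ Lean; the torus typing of `B8Ineq159FlatTorus` / `B8Thm4FlatTorus`, r05 g15/g18).  Tori of record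
`i : TopIdx d L` (`T_η = Tor (fine n M)`, `n = nP i.P = L^K` fine steps per unit, `η = L^{−K}`, `K ≥ 1`, `M_μ = 2L^m` unit cubes per
direction, every `d ≥ 1`, `L` odd `> 1`); ℂ-scalar vector fields `A, J : T_η × Fin d → ℂ`, unit-lattice data `B₁ : Tor M × Fin d → ℂ`;
U₀ = 1, Ω₀ = … = Ω_k = T_η, `L^kη = 1`.  **«‖A‖_{1,β}»** of (1.36) = [4] (3.40) with the transport `R(U(Γ_{x,x′}))` = 1 at U = 1 = [B5]
(1.109)'s Hölder seminorm of the gradient: `B5Prop12FieldsLattice.holderT n M β (grad n M A)` = the supremum over the pairs of bond values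
`((μ,(x,ν)), (μ,(x′,ν)))` (same derivative index μ, same component ν) with `0 < |x − x′| ≦ 1` IN THE η-SCALE (`B5Prop12FieldsLattice.distU` =
sup-metric fine distance / n) of `|(∇_μA_ν)(x′) − (∇_μA_ν)(x)| / |x − x′|^β` (`LatticeNorms.holderSeminormB5`; §0 records
`holderSeminormB9 … (transport := id) = holderSeminormB5`, rfl).  «on Ω_j» for the constant domain sequence = the global seminorm on T_η; the
weights `(Lʲη)^{−2−β} ≥ 1` (j ≦ k) make the level-k reading the binding one (§6 gives the printed «on Ω_j, j = 0, …, k» form with the typed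
p. 86 / (3.41) weight `B8ScaledSupNorm.weight`).  «B₀(β)» = the (1.115) Hölder constant of G(1) = Δ_a⁻¹ (`B5Prop12GHolds.global115_117_famG_printed`,
conjunct `hg1 = ‖∇GJ‖_α ≦ C_α(α)|J|` for `0 ≦ α < 1`, real sources; §2 complexifies), «B₂(β₀) = 5dLB₀(β₀)».

WHAT THIS MODULE PROVES (kernel-checked, 0 sorry; constants chosen BEFORE the torus, the volume and K — «depend on d and L only, B₂(β₀) on
β₀ also»).
§0 `holderSeminormB9_id` (dictionary, rfl), `holderSeminormB5_exponent_mono` (pairs at distance ≦ 1 ⇒ `‖f‖_β ≦ ‖f‖_{β₀}` for β ≦ β₀ — the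
reason ONE constant B₂(β₀) serves every «β ≦ β₀»).
§1 `holder115_real` — [B5] (1.115), Hölder entry `‖∇GJ‖_α ≦ C_α(α)|J|` (0 ≦ α < 1) for REAL vector sources on every torus of record, any
a > 0 (`global115_117_famG_printed` by name).
§2 `holder115_flat` — the same for COMPLEX sources (splitting X = Re X + i·Im X; `B12Ineq331Cutoff.holderSeminorm_add_le`/
`holderSeminorm_const_smul_le` by name; constant `B₀(α) = max(1, 2C_α(α)⁺) ≥ 1`): «B₀(β) … the corresponding [Hölder] norm of the operator
G(U₀)» AT U₀ = 1, one level, hypothesis-free.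
§3 `ineq159_flat_holder` — the Hölder line of (1.59) AT U₀ = 1: for A = G(1)J + G(1)Q_k*B₁ (1.58), `‖∇A‖_β ≦ B₀(β)(|J| + |B₁|)` (0 ≦ β < 1);
`ineq159_flat_holder_printed` — the same from the printed hypotheses (1.55) «D*DA = J», (1.42) «R(1)D*A = 0», (1.56) «Q_kA = B₁»
(`B8Eq158FlatTorus.eq158_line2_torus`).
§4 **`prop3_flat_five`** — PROPOSITION 3 AT U₀ = 1 WITH ALL FIVE MEMBERS OF (1.62): under the printed |J|-line of (1.55), the |B₁|-line after
(1.56), «B₀36dα₂ ≦ 1/2» (+ 50dα₂ ≦ 1) and (1.61): `|A|, |∇A|, |D*DA|, |ΔA| ≦ 5dLB₀(α₀ + α₁)` (as `prop3_flat`, via `B8.apriori_160/162`) AND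
`‖A‖_{1,β} ≦ 5dL·B₀(β₀)·(α₀ + α₁)` for all `β ≦ β₀`, `0 ≦ β₀ < 1` (via `B8Prop3Holder.apriori_160_fifth/apriori_162_fifth`) — «B₂(β₀) = 5dLB₀(β₀)».
§5 **`thm4_flat_five`**, **`thm2_flat_five`** — THEOREMS 4 / 2 AT U₀ = 1 in the linear chart with the COMPLETE conclusion list: ∃! restricted
λ in the Landau gauge, (1.37), the four sup members with B₁ = 5dLB₀ (from `B8Thm4FlatTorus.thm4_flat` by name) AND the Hölder member
`‖A‖_{1,β} ≦ B₂(β₀)(α₀ + α₁)`, B₂(β₀) = 5dL·B₀(β₀), for the gauge-fixed field A = A′ + ∂λ.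
§6 `weight_holder_le` / `thm2_flat_holder_levels` — the printed «(Lʲη)^{−2−β} on Ω_j, j = 0, 1, …, k» reading over the constant domain
sequence: `(Lʲη)^{2+β}·‖A‖_{1,β} ≦ B₂(β₀)(α₀ + α₁)` for every j ≦ k (typed weight `B8ScaledSupNorm.weight L η (−2−β) j`).

HONEST SCOPE.  (i) U₀ = 1 ONLY, one surviving level (constant domain sequence), tori of record, ℂ-scalar fields — exactly the scope of
`B8Ineq159FlatTorus`/`B8Thm4FlatTorus` (their HONEST SCOPE applies verbatim); at a general background the Hölder member is [4] Thm 3.3's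
Hölder entries (3.43)/(3.45) applied to (1.58) (leaf `B9.Thm33Printed`; p40's `B8Prop3Holder` on the ℤᵈ carriers MODULO that line), NOT
proved here.  (ii) At U₀ = 1 print's H(U₀)-term of (1.58) is `G(1)Q_k*B₁` (`eq158_line2_torus`), so «B₀(β₀) … norms of the operators G(U₀),
H(U₀)» collapses to the single (1.115) Hölder constant of G = Δ₁⁻¹; the sup constant B₀ of `ineq159_flat` and the Hölder constant B₀(β) are
chosen independently (both before the torus).  (iii) Constants crude and ours: B₀(β) = max(1, 2C_α(β)⁺) with C_α the tree's (1.115) Hölder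
constant (r02/p37/pv15 lineage); «B₀(β) → ∞ if β → 1» is a property of that input, invisible here; the uniformity in «β ≦ β₀» is §0's
monotonicity (admissible pairs have |x − x′| ≦ 1), print's B₂(β₀) being read as B₂ evaluated at β₀.  (iv) Conclusions `≦` where print has `<`.
(v) Nothing of rows B8.Eq1.36 / B8.Prop3 / B8.Thm2 / B8.Thm4 changes head (owner's standing word: flat instances are cells, not heads).
Value = the last printed member of Theorem 2's conclusion list kernel-checked in the base case to which [4] p. 399 reduces its theorems;
NOT summit progress; nothing here bears on the Yang–Mills mass gap.

RELATED IN THE TREE, NOT DUPLICATED (searched 2026-08-22T18:40Z: `ls Balaban1983to89 | grep -i holder` — B8 stems: `B8Prop3Holder` only;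
HOME FILED/STATUS grep «B8.*Holder» = `B8Prop3Holder`): `B8Prop3Holder` (p40; ℤᵈ carriers, general background, MODULO the (1.59)-lines —
its §3 algebra is USED here), `B9Eq340HolderZd.holder1` (the covariant ‖·‖_{1,β} on ℤᵈ), `B5SupHolderTorus`/`B5Hk163TorusHolder*` (other
B5 operators), `LatticeNorms.holderSeminormB5/B9` (the seminorms), `B12Ineq331Cutoff` (seminorm algebra, USED) — none instantiates the
B8 member on the torus.
-/

noncomputable section

open scoped BigOperators Matrix ComplexConjugate
open Finset Matrix

namespace Literature.MathematicalPhysics.QuantumFieldTheory.Balaban1983to89.B8Eq136HolderFlatTorus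

open B5Prop11Plancherel (Tor fine fdiff)
open B5Action121 (CurlOp GradOp)
open B5Block118 (QvOp QsOp)
open B5DeltaA169 (QvAdj DeltaA)
open B5Prop11Lattice (grad)
open B5Prop11Lower (Lap)
open LatticeNorms (supNorm norm_le_supNorm supNorm_le supNorm_nonneg holderSeminorm holderSeminormB5 holderSeminormB9
  holderSeminorm_le holder_bound holderSeminorm_nonneg)
open B5Prop12FieldsLattice (holderT distU)
open B5SettingP12Real (LocR)
open B5Prop12GHolds (global115_117_famG_printed)
open B5SiteBridgeP12 (nP MP one_le_nP)
open B5ResidualGpTorusHolds (TopIdx)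
open B5RealFields (cplx cplx_apply)
open B5Identities197Torus (RT)
open B8Eq158FlatTorus (G8T eq158_line2_torus)
open B8Ineq159FlatTorus (G8T_one_eq ineq159_flat_printed supNorm_source_le)
open B8Thm4FlatTorus (thm4_flat avg_act_eq dd_act_eq)
open B12Ineq331Cutoff (holderSeminorm_add_le holderSeminorm_const_smul_le)
open B8Prop3Holder (apriori_160_fifth apriori_162_fifth)
open B8ScaledSupNorm (weight weight_nonneg)

variable {d : ℕ}

/-! ## §0 Dictionary and the exponent monotonicity of the Hölder seminorm -/

section HolderAlgebra

variable {ι : Type*} {E : Type*} [SeminormedAddCommGroup E]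

/-- **«‖A‖_{1,β}» of [4] (3.40) at U = 1 is [B5] (1.109)'s seminorm**: with the transport `R(U(Γ_{x,x′}))` the identity, the covariant
Hölder seminorm `holderSeminormB9` IS the plain-difference seminorm `holderSeminormB5` (definitional).
[cite: Balaban1985BackgroundPropagators, (3.40) p.397; Balaban1984PropagatorsI, (1.109) p.35] -/
theorem holderSeminormB9_id (α : ℝ) (sameDir : ι → ι → Prop) (dist : ι → ι → ℝ) (S : Finset ι) (A : ι → E) :
    holderSeminormB9 α sameDir dist (fun _ _ => id) S A = holderSeminormB5 α sameDir dist S A := rfl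

/-- **Exponent monotonicity** of the (1.109)/(3.40) seminorm: its admissible pairs have `|x − x′| ≦ 1`, so `|x − x′|^{β₀} ≦ |x − x′|^β` for
`β ≦ β₀` and `‖f‖_β ≦ ‖f‖_{β₀}` — the reason one constant «B₂(β₀)» serves every «β ≦ β₀ < 1» in (1.36).
[cite: Balaban1985RegularSpaces, (1.36) p.82 («β ≦ β₀ < 1»); Balaban1984PropagatorsI, (1.109) p.35] -/
theorem holderSeminormB5_exponent_mono {β β₀ : ℝ} (hβ : β ≤ β₀) (sameDir : ι → ι → Prop) (dist : ι → ι → ℝ) (S : Finset ι)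
    (f : ι → E) : holderSeminormB5 β sameDir dist S f ≤ holderSeminormB5 β₀ sameDir dist S f := by
  unfold holderSeminormB5
  refine holderSeminorm_le (holderSeminorm_nonneg _ _ _ _ _ _) fun x hx x' hx' hadm hpos => ?_
  have hb := holder_bound (α := β₀) (adm := fun b b' => sameDir b b' ∧ dist b b' ≤ 1) (dist := dist) (τ := fun _ _ => id)
    (S := S) f hx hx' hadm hpos
  exact hb.trans (mul_le_mul_of_nonneg_left (Real.rpow_le_rpow_of_exponent_ge hpos hadm.2 hβ)
    (holderSeminorm_nonneg _ _ _ _ _ _))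

end HolderAlgebra

section HolderT

variable {n : ℕ} [NeZero n] {M : Fin d → ℕ} [∀ μ, NeZero (M μ)]

/-- `‖·‖_{1,β}` is non-negative. [cite: Balaban1984PropagatorsI, (1.109) p.35] -/
theorem holderT_nonneg (β : ℝ) (J : Fin d → (Tor (fine n M) × Fin d → ℂ)) : 0 ≤ holderT n M β J := by
  unfold holderT holderSeminormB5
  exact holderSeminorm_nonneg _ _ _ _ _ _

/-- exponent monotonicity for `‖·‖_{1,β}` = `holderT` (pairs at η-scale distance `≦ 1`): `β ≦ β₀ ⇒ ‖J‖_β ≦ ‖J‖_{β₀}`.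
[cite: Balaban1985RegularSpaces, (1.36) p.82 («β ≦ β₀ < 1»); Balaban1984PropagatorsI, (1.109) p.35] -/
theorem holderT_exponent_mono {β β₀ : ℝ} (hβ : β ≤ β₀) (J : Fin d → (Tor (fine n M) × Fin d → ℂ)) :
    holderT n M β J ≤ holderT n M β₀ J := by
  unfold holderT
  exact holderSeminormB5_exponent_mono hβ _ _ _ _

end HolderT

/-! ## §1 [B5] (1.115), the Hölder entry `‖∇GJ‖_α ≦ O(1)|J|`, real sources, on the tori of record -/

section Real115

variable {L : ℕ}

/-- **[B5] (1.115), Hölder entry, HYPOTHESIS-FREE on the torus family of record** (`B5Prop12GHolds.global115_117_famG_printed` by name, its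
`hg1`-conjunct): ONE function `C_α = C_α(d, L, a; ·)` such that for every torus of record `i`, every `0 ≦ α < 1` and every REAL vector source
`v`: `‖∇Gv‖_α ≦ C_α(α)|v|`, `G = Δ_a⁻¹`, `‖·‖_α` the (1.109) seminorm (pairs |x − x′| ≦ 1 in the η-scale, same μ, ν).
[cite: Balaban1984PropagatorsI, (1.115) p.36, (1.109) p.35, Prop. 1.2 (1.111) p.35] -/
theorem holder115_real (hd : 1 ≤ d) (hL : Odd L ∧ 1 < L) {a : ℝ} (ha : 0 < a) :
    ∃ Cα : ℝ → ℝ, ∀ (i : TopIdx d L) (α : ℝ), 0 ≤ α → α < 1 →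
      ∀ v : Tor (fine (nP i.P) (MP i.P)) × Fin i.P.d → ℝ,
        holderT (nP i.P) (MP i.P) α (grad (nP i.P) (MP i.P) ((DeltaA (nP i.P) (MP i.P) a)⁻¹ *ᵥ cplx v))
          ≤ Cα α * supNorm univ (cplx v) := by
  obtain ⟨C, Cα, Cε, Cαε, hC, h⟩ := global115_117_famG_printed hd hL ha
  refine ⟨Cα, fun i α hα0 hα1 v => ?_⟩
  have := (h i).2.1 α (LocR.vec v) hα0 hα1
  exact this

end Real115

/-! ## §2 Complex sources: the flat one-level Hölder constant «B₀(β)» of Proposition 3 -/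

section Complexify

variable {m : Type*}

/-- `X = Re X + i·Im X` for a complex field. [folklore] -/
private theorem re_add_im_decomp (X : m → ℂ) :
    X = cplx (fun b => (X b).re) + Complex.I • cplx (fun b => (X b).im) := by
  funext b
  simp only [Pi.add_apply, Pi.smul_apply, cplx_apply, smul_eq_mul]
  rw [mul_comm, Complex.re_add_im]

variable [Fintype m]

/-- `|Re X| ≦ |X|`. [folklore] -/
private theorem supNorm_re_le (X : m → ℂ) : supNorm univ (cplx fun b => (X b).re) ≤ supNorm univ X :=
  supNorm_le (supNorm_nonneg _ _) fun b hb => by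
    rw [cplx_apply, Complex.norm_real, Real.norm_eq_abs]
    exact (Complex.abs_re_le_norm _).trans (norm_le_supNorm X hb)

/-- `|Im X| ≦ |X|`. [folklore] -/
private theorem supNorm_im_le (X : m → ℂ) : supNorm univ (cplx fun b => (X b).im) ≤ supNorm univ X :=
  supNorm_le (supNorm_nonneg _ _) fun b hb => by
    rw [cplx_apply, Complex.norm_real, Real.norm_eq_abs]
    exact (Complex.abs_im_le_norm _).trans (norm_le_supNorm X hb)

end Complexify

section Flat115

variable {L : ℕ}

/-- the gradient field of `G X` splits along `X = Re X + i·Im X` (G, ∇ are ℂ-linear). [folklore] -/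
private theorem grad_mulVec_decomp {n : ℕ} [NeZero n] {M : Fin d → ℕ} [∀ μ, NeZero (M μ)]
    (G : Matrix (Tor (fine n M) × Fin d) (Tor (fine n M) × Fin d) ℂ) (X : Tor (fine n M) × Fin d → ℂ) :
    (fun p : Fin d × (Tor (fine n M) × Fin d) => grad n M (G *ᵥ X) p.1 p.2)
      = (fun p : Fin d × (Tor (fine n M) × Fin d) => grad n M (G *ᵥ cplx fun b => (X b).re) p.1 p.2)
        + fun p : Fin d × (Tor (fine n M) × Fin d) =>
            Complex.I • grad n M (G *ᵥ cplx fun b => (X b).im) p.1 p.2 := by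
  funext p
  have hX : G *ᵥ X = G *ᵥ cplx (fun b => (X b).re) + Complex.I • (G *ᵥ cplx fun b => (X b).im) := by
    conv_lhs => rw [re_add_im_decomp X]
    rw [Matrix.mulVec_add, Matrix.mulVec_smul]
  simp only [Pi.add_apply, grad, hX, Matrix.mulVec_add, Matrix.mulVec_smul, Pi.smul_apply]

/-- **Real operators, complex sources, Hölder form**: a bound `‖∇Gv‖_α ≦ C|v|` for REAL sources `v` gives `‖∇GX‖_α ≦ 2C|X|` for complex
`X` (splitting `X = Re X + i Im X`, seminorm subadditivity `B12Ineq331Cutoff.holderSeminorm_add_le` and `‖i·f‖_α ≦ ‖f‖_α`; the device by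
which [B5]'s real-field (1.115) serves the ℂ-scalar typing of the torus files, cf. `B8Ineq159FlatTorus` §2). [folklore] -/
private theorem holderT_grad_mulVec_le_of_real {n : ℕ} [NeZero n] {M : Fin d → ℕ} [∀ μ, NeZero (M μ)]
    (G : Matrix (Tor (fine n M) × Fin d) (Tor (fine n M) × Fin d) ℂ) {α C : ℝ} (hC : 0 ≤ C)
    (h : ∀ v : Tor (fine n M) × Fin d → ℝ, holderT n M α (grad n M (G *ᵥ cplx v)) ≤ C * supNorm univ (cplx v))
    (X : Tor (fine n M) × Fin d → ℂ) :
    holderT n M α (grad n M (G *ᵥ X)) ≤ 2 * C * supNorm univ X := by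
  have hre : holderT n M α (grad n M (G *ᵥ cplx fun b => (X b).re)) ≤ C * supNorm univ X :=
    (h fun b => (X b).re).trans (mul_le_mul_of_nonneg_left (supNorm_re_le X) hC)
  have him : holderT n M α (grad n M (G *ᵥ cplx fun b => (X b).im)) ≤ C * supNorm univ X :=
    (h fun b => (X b).im).trans (mul_le_mul_of_nonneg_left (supNorm_im_le X) hC)
  have hsplit : holderT n M α (grad n M (G *ᵥ X))
      ≤ holderT n M α (grad n M (G *ᵥ cplx fun b => (X b).re))
        + ‖Complex.I‖ * holderT n M α (grad n M (G *ᵥ cplx fun b => (X b).im)) := by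
    unfold holderT holderSeminormB5
    rw [grad_mulVec_decomp G X]
    refine (holderSeminorm_add_le α _ _ _ _ _).trans (add_le_add le_rfl ?_)
    exact holderSeminorm_const_smul_le α _ _ _ Complex.I _
  rw [Complex.norm_I, one_mul] at hsplit
  calc holderT n M α (grad n M (G *ᵥ X)) ≤ C * supNorm univ X + C * supNorm univ X := hsplit.trans (add_le_add hre him)
    _ = 2 * C * supNorm univ X := by ring

/-- **«B₀(β) … the corresponding [Hölder] norm of the operator G(U₀)» AT U₀ = 1, one level, a > 0, HYPOTHESIS-FREE on the tori of record**:
ONE function `B₀(·) = B₀(d, L, a; ·) ≥ 1` with `‖∇GX‖_α ≦ B₀(α)|X|` for every `0 ≦ α < 1` and EVERY complex vector source X, `G = Δ_a⁻¹` —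
[B5] (1.115)'s Hölder entry (§1) complexified (X = Re X + i Im X; `B₀(α) = max(1, 2C_α(α)⁺)`), i.e. the Hölder entry of [4] Thm 3.3 for G(U)
at U = 1 («reduced to the corresponding theorems for propagators without external gauge field», [4] p. 399).
[cite: Balaban1985RegularSpaces, Prop. 3 p.87 («B₀(β₀) … norms of the operators G(U₀), H(U₀)»); Balaban1984PropagatorsI, (1.115) p.36;
Balaban1985BackgroundPropagators, Thm 3.3 p.399, (3.43) p.398] -/
theorem holder115_flat (hd : 1 ≤ d) (hL : Odd L ∧ 1 < L) {a : ℝ} (ha : 0 < a) :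
    ∃ B₀H : ℝ → ℝ, (∀ α, 1 ≤ B₀H α) ∧ ∀ (i : TopIdx d L) (α : ℝ), 0 ≤ α → α < 1 →
      ∀ X : Tor (fine (nP i.P) (MP i.P)) × Fin i.P.d → ℂ,
        holderT (nP i.P) (MP i.P) α (grad (nP i.P) (MP i.P) ((DeltaA (nP i.P) (MP i.P) a)⁻¹ *ᵥ X))
          ≤ B₀H α * supNorm univ X := by
  obtain ⟨Cα, h⟩ := holder115_real hd hL ha
  refine ⟨fun α => max 1 (2 * max 0 (Cα α)), fun α => le_max_left _ _, fun i α hα0 hα1 X => ?_⟩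
  show _ ≤ max 1 (2 * max 0 (Cα α)) * supNorm univ X
  have hC'0 : 0 ≤ max 0 (Cα α) := le_max_left _ _
  have hreal : ∀ v : Tor (fine (nP i.P) (MP i.P)) × Fin i.P.d → ℝ,
      holderT (nP i.P) (MP i.P) α (grad (nP i.P) (MP i.P) ((DeltaA (nP i.P) (MP i.P) a)⁻¹ *ᵥ cplx v))
        ≤ max 0 (Cα α) * supNorm univ (cplx v) := fun v =>
    (h i α hα0 hα1 v).trans (mul_le_mul_of_nonneg_right (le_max_right _ _) (supNorm_nonneg _ _))
  exact (holderT_grad_mulVec_le_of_real _ hC'0 hreal X).trans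
    (mul_le_mul_of_nonneg_right (le_max_right _ _) (supNorm_nonneg _ _))

end Flat115

/-! ## §3 The Hölder line of (1.59) at U₀ = 1 for the constant domain sequence -/

section Ineq159Holder

variable {L : ℕ}

/-- **The Hölder line behind (1.59)/(1.62) AT THE FLAT BACKGROUND, plain form, HYPOTHESIS-FREE**: there is ONE function
`B₀(·) = B₀(d, L; ·) ≥ 1` such that on EVERY torus of record `i`, for every bond source `J`, unit-lattice datum `B₁` and every `A` given by
(1.58) at U₀ = 1, one level, `A = G(1)J + G(1)Q_k*B₁`: `‖A‖_{1,β} = ‖∇A‖_β ≦ B₀(β)(|J| + |B₁|)` for every `0 ≦ β < 1` — print's «B₀(β₀) …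
the corresponding norms of the operators G(U₀), H(U₀)» applied to (1.58) (at U₀ = 1 the H(U₀)-term is `G(1)Q_k*B₁`, `|Q_k*B₁| ≦ |B₁|`).
[cite: Balaban1985RegularSpaces, (1.58)–(1.59) p.86, (1.62) + Prop. 3 p.87; Balaban1985BackgroundPropagators, Thm 3.3 p.399;
Balaban1984PropagatorsI, (1.115) p.36] -/
theorem ineq159_flat_holder (hd : 1 ≤ d) (hL : Odd L ∧ 1 < L) :
    ∃ B₀H : ℝ → ℝ, (∀ β, 1 ≤ B₀H β) ∧ ∀ (i : TopIdx d L) (J A : Tor (fine (nP i.P) (MP i.P)) × Fin i.P.d → ℂ)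
      (B₁ : Tor (MP i.P) × Fin i.P.d → ℂ),
      A = G8T (nP i.P) (MP i.P) 1 *ᵥ J + G8T (nP i.P) (MP i.P) 1 *ᵥ (QvAdj (nP i.P) (MP i.P) *ᵥ B₁) →
      ∀ β : ℝ, 0 ≤ β → β < 1 →
        holderT (nP i.P) (MP i.P) β (grad (nP i.P) (MP i.P) A) ≤ B₀H β * (supNorm univ J + supNorm univ B₁) := by
  obtain ⟨B₀H, hB1, h⟩ := holder115_flat hd hL one_pos
  refine ⟨B₀H, hB1, fun i J A B₁ hA β hβ0 hβ1 => ?_⟩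
  set X : Tor (fine (nP i.P) (MP i.P)) × Fin i.P.d → ℂ := J + QvAdj (nP i.P) (MP i.P) *ᵥ B₁ with hXdef
  have hXle : supNorm univ X ≤ supNorm univ J + supNorm univ B₁ := supNorm_source_le _ _ J B₁
  have hA' : A = (DeltaA (nP i.P) (MP i.P) 1)⁻¹ *ᵥ X := by
    rw [hA, ← Matrix.mulVec_add, G8T_one_eq]
  rw [hA']
  exact (h i β hβ0 hβ1 X).trans (mul_le_mul_of_nonneg_left hXle (zero_le_one.trans (hB1 β)))

/-- **The Hölder line of (1.59) from the printed hypotheses of pp. 83–86** — (1.55) «D^{η*}_{U₀}D^η_{U₀}A = J», (1.42) «R(U₀)D^{η*}_{U₀}A = 0»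
and (1.56) «L^kηQ_kA = B₁» (L^kη = 1) — at U₀ = 1 on every torus of record: then (1.58) holds (`B8Eq158FlatTorus.eq158_line2_torus`) and
`‖∇A‖_β ≦ B₀(β)(|J| + |B₁|)` for every `0 ≦ β < 1`, with the B₀(·) of `ineq159_flat_holder`.
[cite: Balaban1985RegularSpaces, (1.55)–(1.59) p.86, (1.42) p.83, (1.62) p.87] -/
theorem ineq159_flat_holder_printed (hd : 1 ≤ d) (hL : Odd L ∧ 1 < L) :
    ∃ B₀H : ℝ → ℝ, (∀ β, 1 ≤ B₀H β) ∧ ∀ (i : TopIdx d L) (J A : Tor (fine (nP i.P) (MP i.P)) × Fin i.P.d → ℂ)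
      (B₁ : Tor (MP i.P) × Fin i.P.d → ℂ),
      (1 / 2 : ℂ) • ((CurlOp (fine (nP i.P) (MP i.P)) ((nP i.P : ℕ) : ℂ))ᴴ *ᵥ
          (CurlOp (fine (nP i.P) (MP i.P)) ((nP i.P : ℕ) : ℂ) *ᵥ A)) = J →
      RT (nP i.P) (MP i.P) *ᵥ ((GradOp (fine (nP i.P) (MP i.P)) ((nP i.P : ℕ) : ℂ))ᴴ *ᵥ A) = 0 →
      QvOp (nP i.P) (MP i.P) *ᵥ A = B₁ →
      ∀ β : ℝ, 0 ≤ β → β < 1 →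
        holderT (nP i.P) (MP i.P) β (grad (nP i.P) (MP i.P) A) ≤ B₀H β * (supNorm univ J + supNorm univ B₁) := by
  obtain ⟨B₀H, hB1, h⟩ := ineq159_flat_holder hd hL
  refine ⟨B₀H, hB1, fun i J A B₁ h55 h42 h56 => ?_⟩
  have h56' : ((1 : ℝ) : ℂ) • (QvOp (nP i.P) (MP i.P) *ᵥ A) = B₁ := by rw [Complex.ofReal_one, one_smul, h56]
  have h58 := eq158_line2_torus (nP i.P) (MP i.P) (one_le_nP i.P) one_pos h55 h42 h56'
  simp only [inv_one, one_pow, Complex.ofReal_one, one_smul] at h58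
  exact h i J A B₁ h58

end Ineq159Holder

/-! ## §4 Proposition 3 at U₀ = 1 with ALL FIVE members of (1.62) -/

section Prop3Five

variable {L : ℕ}

/-- **PROPOSITION 3 / (1.62) AT THE FLAT BACKGROUND U₀ = 1 — ALL FIVE MEMBERS, including the Hölder member «‖A‖_{1,β} < 5dLB₀(β)(α₀ + α₁)
(Lʲη)^{−2−β}», «B₂(β₀) = 5dLB₀(β₀)»** (constant domain sequence, every torus of record; p. 87).  With ONE sup constant `B₀ = B₀(d, L) ≥ 1`
(that of `B8Ineq159FlatTorus.ineq159_flat`) and ONE Hölder constant function `B₀(·) ≥ 1` (§3), for every A with (1.55) «D^{η*}D^ηA = J»,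
(1.42) «R(1)D^{η*}A = 0», (1.56) «Q_kA = B₁» whose sources obey the PRINTED sizes — the |J|-line of (1.55) «|J| ≦ 2α₀ + 36dα₂|∇A| + 50dα₂³ +
10dα₀α₂» and the |B₁|-line after (1.56) «|B₁| ≦ 2dLα₁ + C₂α₂²» —, under «B₀36dα₂ ≦ 1/2» (+ 50dα₂ ≦ 1) and (1.61): the four sup members
`|A|, |∇A|, |D*DA|, |ΔA| ≦ 5dLB₀(α₀ + α₁)` (`B8.apriori_160`/`apriori_162` by name, as `prop3_flat`) AND, for every `0 ≦ β₀ < 1` and every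
`β ≦ β₀`, THE HÖLDER MEMBER `‖A‖_{1,β} = ‖∇A‖_β ≦ 5dL·B₀(β₀)·(α₀ + α₁)` (`B8Prop3Holder.apriori_160_fifth`/`apriori_162_fifth` by name at
β₀ — no smallness condition involves B₀(β₀) — and §0's exponent monotonicity for β ≦ β₀).  L^kη = 1, so the weights (Lʲη)^{−1,−2,−2−β,−3} of
(1.62) are 1 at the surviving level (§6 for every j ≦ k).  HONEST SCOPE (i)–(v) of the header.
[cite: Balaban1985RegularSpaces, Prop. 3 + (1.61)–(1.62) pp.86–87, (1.55)–(1.60) p.86, (1.36) p.82, (1.39) p.83] -/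
theorem prop3_flat_five (hd : 1 ≤ d) (hL : Odd L ∧ 1 < L) :
    ∃ B₀ : ℝ, ∃ B₀H : ℝ → ℝ, 1 ≤ B₀ ∧ (∀ β, 1 ≤ B₀H β) ∧
      ∀ (i : TopIdx d L) (J A : Tor (fine (nP i.P) (MP i.P)) × Fin i.P.d → ℂ)
      (B₁ : Tor (MP i.P) × Fin i.P.d → ℂ) (α₀ α₁ α₂ C₂ : ℝ),
      (1 / 2 : ℂ) • ((CurlOp (fine (nP i.P) (MP i.P)) ((nP i.P : ℕ) : ℂ))ᴴ *ᵥ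
          (CurlOp (fine (nP i.P) (MP i.P)) ((nP i.P : ℕ) : ℂ) *ᵥ A)) = J →
      RT (nP i.P) (MP i.P) *ᵥ ((GradOp (fine (nP i.P) (MP i.P)) ((nP i.P : ℕ) : ℂ))ᴴ *ᵥ A) = 0 →
      QvOp (nP i.P) (MP i.P) *ᵥ A = B₁ →
      0 ≤ α₀ → 0 ≤ α₁ → 0 ≤ α₂ →
      supNorm univ J ≤ 2 * α₀ + 36 * d * α₂ *
          supNorm univ (fun p : Fin i.P.d × (Tor (fine (nP i.P) (MP i.P)) × Fin i.P.d) => grad (nP i.P) (MP i.P) A p.1 p.2)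
        + 50 * d * α₂ ^ 3 + 10 * d * α₀ * α₂ →
      supNorm univ B₁ ≤ 2 * d * L * α₁ + C₂ * α₂ ^ 2 →
      36 * d * B₀ * α₂ ≤ 1 / 2 → 50 * d * α₂ ≤ 1 →
      2 * α₂ ^ 2 + 20 * d * α₀ * α₂ + 2 * C₂ * α₂ ^ 2 ≤ α₀ + α₁ →
      (∀ b, ‖A b‖ ≤ 5 * d * L * B₀ * (α₀ + α₁)) ∧
      (∀ ν b, ‖grad (nP i.P) (MP i.P) A ν b‖ ≤ 5 * d * L * B₀ * (α₀ + α₁)) ∧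
      (∀ b, ‖((1 / 2 : ℂ) • ((CurlOp (fine (nP i.P) (MP i.P)) ((nP i.P : ℕ) : ℂ))ᴴ *ᵥ
          (CurlOp (fine (nP i.P) (MP i.P)) ((nP i.P : ℕ) : ℂ) *ᵥ A))) b‖ ≤ 5 * d * L * B₀ * (α₀ + α₁)) ∧
      (∀ b, ‖(Lap (nP i.P) (MP i.P) *ᵥ A) b‖ ≤ 5 * d * L * B₀ * (α₀ + α₁)) ∧
      (∀ β₀ β : ℝ, 0 ≤ β₀ → β₀ < 1 → β ≤ β₀ →
        holderT (nP i.P) (MP i.P) β (grad (nP i.P) (MP i.P) A) ≤ 5 * d * L * B₀H β₀ * (α₀ + α₁)) := by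
  obtain ⟨B₀, hB₀, h⟩ := ineq159_flat_printed hd hL
  obtain ⟨B₀H, hBH, hH⟩ := ineq159_flat_holder_printed hd hL
  refine ⟨B₀, B₀H, hB₀, hBH, fun i J A B₁ α₀ α₁ α₂ C₂ h55 h42 h56 hα₀ hα₁ hα₂ hJ hB hside h50 h61 => ?_⟩
  obtain ⟨hAb, hgr, hdd, hlap⟩ := h i J A B₁ h55 h42 h56
  have hB₀' : 0 ≤ B₀ := zero_le_one.trans hB₀
  have hsum : 0 ≤ B₀ * (supNorm univ J + supNorm univ B₁) :=
    mul_nonneg hB₀' (add_nonneg (supNorm_nonneg _ _) (supNorm_nonneg _ _))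
  have hdL : (1 : ℝ) ≤ (d : ℝ) * (L : ℝ) := by
    have h1 : (1 : ℝ) ≤ d := by exact_mod_cast hd
    have h2 : (1 : ℝ) ≤ L := by exact_mod_cast hL.2.le
    nlinarith
  have hdR : (0 : ℝ) ≤ d := Nat.cast_nonneg d
  -- the four norms of (1.59) as numbers
  set gF : Fin i.P.d × (Tor (fine (nP i.P) (MP i.P)) × Fin i.P.d) → ℂ :=
    fun p => grad (nP i.P) (MP i.P) A p.1 p.2 with hgF
  set DD : Tor (fine (nP i.P) (MP i.P)) × Fin i.P.d → ℂ :=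
    (1 / 2 : ℂ) • ((CurlOp (fine (nP i.P) (MP i.P)) ((nP i.P : ℕ) : ℂ))ᴴ *ᵥ
      (CurlOp (fine (nP i.P) (MP i.P)) ((nP i.P : ℕ) : ℂ) *ᵥ A)) with hDD
  have h59a : supNorm univ A ≤ B₀ * (supNorm univ J + supNorm univ B₁) := supNorm_le hsum fun b _ => hAb b
  have h59g : supNorm univ gF ≤ B₀ * (supNorm univ J + supNorm univ B₁) := supNorm_le hsum fun p _ => hgr p.1 p.2
  have h59j : supNorm univ DD ≤ B₀ * (supNorm univ J + supNorm univ B₁) := supNorm_le hsum fun b _ => hdd b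
  have h59l : supNorm univ (Lap (nP i.P) (MP i.P) *ᵥ A) ≤ B₀ * (supNorm univ J + supNorm univ B₁) :=
    supNorm_le hsum fun b _ => hlap b
  -- (1.60) + (1.62) for the four sup members
  obtain ⟨ha, hg, hj, hl⟩ := B8.apriori_160 (L := (L : ℝ)) (C₂ := C₂) (α₁ := α₁) hdR hB₀' hα₂ (supNorm_nonneg _ gF)
    hJ hB h59a h59g h59j h59l hside h50
  have h162 := B8.apriori_162 (C₂ := C₂) (α₂ := α₂) hB₀' hdL hα₀ hα₁ h61
  refine ⟨fun b => ((norm_le_supNorm A (Finset.mem_univ b)).trans ha).trans h162,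
    fun ν b => ((norm_le_supNorm gF (Finset.mem_univ (ν, b))).trans hg).trans h162,
    fun b => ((norm_le_supNorm DD (Finset.mem_univ b)).trans hj).trans h162,
    fun b => ((norm_le_supNorm (Lap (nP i.P) (MP i.P) *ᵥ A) (Finset.mem_univ b)).trans hl).trans h162,
    fun β₀ β hβ₀0 hβ₀1 hββ₀ => ?_⟩
  -- the fifth member at β₀, then every β ≤ β₀ by monotonicity
  have h59h := hH i J A B₁ h55 h42 h56 β₀ hβ₀0 hβ₀1
  have hBH0 : 0 ≤ B₀H β₀ := zero_le_one.trans (hBH β₀)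
  have h160 := apriori_160_fifth (L := (L : ℝ)) (C₂ := C₂) (α₁ := α₁) hdR hB₀' hBH0 hα₀ hα₂ (supNorm_nonneg _ gF)
    (supNorm_nonneg _ B₁) hJ hB h59g h59h hside h50
  have h5 := apriori_162_fifth hBH0 hdL hα₀ hα₁ h61 h160
  exact (holderT_exponent_mono hββ₀ _).trans h5

end Prop3Five

/-! ## §5 Theorems 4 / 2 at U₀ = 1 with the complete conclusion list (1.36)–(1.39) -/

section Main

variable {L : ℕ}

/-- **THEOREM 4 AT THE FLAT BACKGROUND U₀ = 1 (linear chart, constant domain sequence, tori of record) WITH THE COMPLETE LIST (1.36)–(1.39),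
HYPOTHESIS-FREE.**  There are ONE constant `B₁ = 5dLB₀(d, L) ≥ 1` and ONE function `B₂(·) = 5dL·B₀(·) ≥ 1` (Prop. 3's «B₁ = 5dLB₀,
B₂(β₀) = 5dLB₀(β₀)») such that for every torus of record `i`, all `α₀, α₁ ≥ 0` and every perturbation A′ with `sup|D*DA′| ≦ 2α₀` and
`sup|Q_kA′| ≦ 2dLα₁`: (i) ∃! λ with `Q′_kλ = 0 ∧ R∂ᴴ(A′ + ∂λ) = 0` («exactly one gauge transformation u satisfying (1.29) and … (1.38)»);
(ii) for every such λ the field `A = A′ + ∂λ` satisfies (1.37) `Q_kA = Q_kA′`, the four sup members `|A(b)|, |(∇A)(ν,b)|, |(D*DA)(b)|, |(ΔA)(b)|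
≦ B₁(α₀ + α₁)` (these from `B8Thm4FlatTorus.thm4_flat` BY NAME) AND THE HÖLDER MEMBER of (1.36): `‖A‖_{1,β} = ‖∇A‖_β ≦ B₂(β₀)(α₀ + α₁)`
for every `0 ≦ β₀ < 1`, `β ≦ β₀` (§3 with |J| ≦ 2α₀, |B₁| ≦ 2dLα₁, `2α₀ + 2dLα₁ ≦ 5dL(α₀ + α₁)`; no bootstrap is needed in the linear chart).
[cite: Balaban1985RegularSpaces, Thm 4 p.88, (1.67) p.88, (1.36)–(1.38) p.82, (1.39) p.83, Prop. 3 (1.62) p.87, (1.55)–(1.59) p.86;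
Balaban1984PropagatorsI, (1.115) p.36, (1.109) p.35] -/
theorem thm4_flat_five (hd : 1 ≤ d) (hL : Odd L ∧ 1 < L) :
    ∃ B₁ : ℝ, ∃ B₂ : ℝ → ℝ, 1 ≤ B₁ ∧ (∀ β₀, 1 ≤ B₂ β₀) ∧
      ∀ (i : TopIdx d L) (α₀ α₁ : ℝ) (A' : Tor (fine (nP i.P) (MP i.P)) × Fin i.P.d → ℂ),
      0 ≤ α₀ → 0 ≤ α₁ →
      (∀ b, ‖((1 / 2 : ℂ) • ((CurlOp (fine (nP i.P) (MP i.P)) ((nP i.P : ℕ) : ℂ))ᴴ *ᵥ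
          (CurlOp (fine (nP i.P) (MP i.P)) ((nP i.P : ℕ) : ℂ) *ᵥ A'))) b‖ ≤ 2 * α₀) →
      (∀ c, ‖(QvOp (nP i.P) (MP i.P) *ᵥ A') c‖ ≤ 2 * d * L * α₁) →
      (∃! lam : Tor (fine (nP i.P) (MP i.P)) → ℂ, QsOp (nP i.P) (MP i.P) *ᵥ lam = 0 ∧
        RT (nP i.P) (MP i.P) *ᵥ ((GradOp (fine (nP i.P) (MP i.P)) ((nP i.P : ℕ) : ℂ))ᴴ *ᵥ
          (A' + GradOp (fine (nP i.P) (MP i.P)) ((nP i.P : ℕ) : ℂ) *ᵥ lam)) = 0) ∧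
      ∀ lam : Tor (fine (nP i.P) (MP i.P)) → ℂ, QsOp (nP i.P) (MP i.P) *ᵥ lam = 0 →
        RT (nP i.P) (MP i.P) *ᵥ ((GradOp (fine (nP i.P) (MP i.P)) ((nP i.P : ℕ) : ℂ))ᴴ *ᵥ
          (A' + GradOp (fine (nP i.P) (MP i.P)) ((nP i.P : ℕ) : ℂ) *ᵥ lam)) = 0 →
        QvOp (nP i.P) (MP i.P) *ᵥ (A' + GradOp (fine (nP i.P) (MP i.P)) ((nP i.P : ℕ) : ℂ) *ᵥ lam)
            = QvOp (nP i.P) (MP i.P) *ᵥ A' ∧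
        (∀ b, ‖(A' + GradOp (fine (nP i.P) (MP i.P)) ((nP i.P : ℕ) : ℂ) *ᵥ lam) b‖ ≤ B₁ * (α₀ + α₁)) ∧
        (∀ ν b, ‖grad (nP i.P) (MP i.P) (A' + GradOp (fine (nP i.P) (MP i.P)) ((nP i.P : ℕ) : ℂ) *ᵥ lam) ν b‖
            ≤ B₁ * (α₀ + α₁)) ∧
        (∀ b, ‖((1 / 2 : ℂ) • ((CurlOp (fine (nP i.P) (MP i.P)) ((nP i.P : ℕ) : ℂ))ᴴ *ᵥ
            (CurlOp (fine (nP i.P) (MP i.P)) ((nP i.P : ℕ) : ℂ) *ᵥ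
              (A' + GradOp (fine (nP i.P) (MP i.P)) ((nP i.P : ℕ) : ℂ) *ᵥ lam)))) b‖ ≤ B₁ * (α₀ + α₁)) ∧
        (∀ b, ‖(Lap (nP i.P) (MP i.P) *ᵥ (A' + GradOp (fine (nP i.P) (MP i.P)) ((nP i.P : ℕ) : ℂ) *ᵥ lam)) b‖
            ≤ B₁ * (α₀ + α₁)) ∧
        (∀ β₀ β : ℝ, 0 ≤ β₀ → β₀ < 1 → β ≤ β₀ →
          holderT (nP i.P) (MP i.P) β
              (grad (nP i.P) (MP i.P) (A' + GradOp (fine (nP i.P) (MP i.P)) ((nP i.P : ℕ) : ℂ) *ᵥ lam))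
            ≤ B₂ β₀ * (α₀ + α₁)) := by
  obtain ⟨B₁, hB₁, h4⟩ := thm4_flat hd hL
  obtain ⟨B₀H, hBH, hH⟩ := ineq159_flat_holder_printed hd hL
  have hdL : (1 : ℝ) ≤ (d : ℝ) * (L : ℝ) := by
    have h1 : (1 : ℝ) ≤ d := by exact_mod_cast hd
    have h2 : (1 : ℝ) ≤ L := by exact_mod_cast hL.2.le
    nlinarith
  refine ⟨B₁, fun β₀ => 5 * d * L * B₀H β₀, hB₁, fun β₀ => ?_, fun i α₀ α₁ A' hα₀ hα₁ hJ hQ => ?_⟩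
  · -- `1 ≤ 5dL·B₀(β₀)`
    calc (1 : ℝ) ≤ 5 * ((d : ℝ) * L) * 1 := by linarith
      _ ≤ 5 * ((d : ℝ) * L) * B₀H β₀ := mul_le_mul_of_nonneg_left (hBH β₀) (by positivity)
      _ = 5 * d * L * B₀H β₀ := by ring
  obtain ⟨hex, hall⟩ := h4 i α₀ α₁ A' hα₀ hα₁ hJ hQ
  refine ⟨hex, fun lam hlam hLan => ?_⟩
  obtain ⟨h37, hA, hg, hdd, hl⟩ := hall lam hlam hLan
  refine ⟨h37, hA, hg, hdd, hl, fun β₀ β hβ₀0 hβ₀1 hββ₀ => ?_⟩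
  -- the gauge-fixed field and its (1.55)/(1.56) data
  set A : Tor (fine (nP i.P) (MP i.P)) × Fin i.P.d → ℂ :=
    A' + GradOp (fine (nP i.P) (MP i.P)) ((nP i.P : ℕ) : ℂ) *ᵥ lam with hAdef
  set J : Tor (fine (nP i.P) (MP i.P)) × Fin i.P.d → ℂ :=
    (1 / 2 : ℂ) • ((CurlOp (fine (nP i.P) (MP i.P)) ((nP i.P : ℕ) : ℂ))ᴴ *ᵥ
      (CurlOp (fine (nP i.P) (MP i.P)) ((nP i.P : ℕ) : ℂ) *ᵥ A)) with hJdef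
  set B₁' : Tor (MP i.P) × Fin i.P.d → ℂ := QvOp (nP i.P) (MP i.P) *ᵥ A with hB1def
  have h37' : B₁' = QvOp (nP i.P) (MP i.P) *ᵥ A' := by rw [hB1def, hAdef, avg_act_eq _ _ A' hlam]
  have h55J : J = (1 / 2 : ℂ) • ((CurlOp (fine (nP i.P) (MP i.P)) ((nP i.P : ℕ) : ℂ))ᴴ *ᵥ
      (CurlOp (fine (nP i.P) (MP i.P)) ((nP i.P : ℕ) : ℂ) *ᵥ A')) := by rw [hJdef, hAdef, dd_act_eq]
  -- sizes: |J| ≤ 2α₀, |B₁| ≤ 2dLα₁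
  have hJsup : supNorm univ J ≤ 2 * α₀ := supNorm_le (by linarith) fun b _ => by rw [h55J]; exact hJ b
  have hBsup : supNorm univ B₁' ≤ 2 * d * L * α₁ := supNorm_le (by positivity) fun c _ => by rw [h37']; exact hQ c
  -- the Hölder line at β₀, then monotonicity
  have hβ₀ := hH i J A B₁' rfl hLan rfl β₀ hβ₀0 hβ₀1
  have hBH0 : 0 ≤ B₀H β₀ := zero_le_one.trans (hBH β₀)
  have hbound : B₀H β₀ * (supNorm univ J + supNorm univ B₁') ≤ 5 * d * L * B₀H β₀ * (α₀ + α₁) := by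
    have h1 : supNorm univ J + supNorm univ B₁' ≤ 2 * α₀ + 2 * d * L * α₁ := add_le_add hJsup hBsup
    have h2 : 2 * α₀ + 2 * d * L * α₁ ≤ 5 * d * L * (α₀ + α₁) := by
      nlinarith [mul_nonneg (sub_nonneg.2 hdL) hα₀, mul_nonneg (sub_nonneg.2 hdL) hα₁]
    calc B₀H β₀ * (supNorm univ J + supNorm univ B₁') ≤ B₀H β₀ * (5 * d * L * (α₀ + α₁)) :=
          mul_le_mul_of_nonneg_left (h1.trans h2) hBH0
      _ = 5 * d * L * B₀H β₀ * (α₀ + α₁) := by ring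
  exact (holderT_exponent_mono hββ₀ _).trans (hβ₀.trans hbound)

/-- **THEOREM 2 AT THE FLAT BACKGROUND U₀ = 1 WITH THE COMPLETE LIST (1.36)–(1.39)** («Of course this theorem implies Theorem 2», p. 88):
with the constants B₁ = 5dLB₀, B₂(β₀) = 5dLB₀(β₀) of `thm4_flat_five` — «there exists exactly one gauge transformation u satisfying (1.29) and
such that the conditions (1.36)–(1.39) hold for the configuration U₁ = U′^{u⁻¹}» — read in the linear chart at the surviving level: ∃! restricted
λ in the Landau gauge (1.38), and for it (1.36) `|A|, |∇^η_{U₀}A| ≦ B₁(α₀ + α₁)`, `‖A‖_{1,β} ≦ B₂(β₀)(α₀ + α₁)` (β ≦ β₀ < 1), (1.37) `Q_kA = Q_kA′`,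
(1.39) `|D^{η*}_{U₀}D^η_{U₀}A|, |Δ^η_{U₀}A| ≦ B₁(α₀ + α₁)`.  This completes the printed conclusion list of `B8Thm4FlatTorus.thm2_flat` in its own
scope. [cite: Balaban1985RegularSpaces, Thm 2 p.83, (1.36)–(1.38) p.82, (1.39) p.83, Thm 4 p.88, Prop. 3 p.87] -/
theorem thm2_flat_five (hd : 1 ≤ d) (hL : Odd L ∧ 1 < L) :
    ∃ B₁ : ℝ, ∃ B₂ : ℝ → ℝ, 1 ≤ B₁ ∧ (∀ β₀, 1 ≤ B₂ β₀) ∧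
      ∀ (i : TopIdx d L) (α₀ α₁ : ℝ) (A' : Tor (fine (nP i.P) (MP i.P)) × Fin i.P.d → ℂ),
      0 ≤ α₀ → 0 ≤ α₁ →
      (∀ b, ‖((1 / 2 : ℂ) • ((CurlOp (fine (nP i.P) (MP i.P)) ((nP i.P : ℕ) : ℂ))ᴴ *ᵥ
          (CurlOp (fine (nP i.P) (MP i.P)) ((nP i.P : ℕ) : ℂ) *ᵥ A'))) b‖ ≤ 2 * α₀) →
      (∀ c, ‖(QvOp (nP i.P) (MP i.P) *ᵥ A') c‖ ≤ 2 * d * L * α₁) →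
      ∃! lam : Tor (fine (nP i.P) (MP i.P)) → ℂ, QsOp (nP i.P) (MP i.P) *ᵥ lam = 0 ∧
        RT (nP i.P) (MP i.P) *ᵥ ((GradOp (fine (nP i.P) (MP i.P)) ((nP i.P : ℕ) : ℂ))ᴴ *ᵥ
          (A' + GradOp (fine (nP i.P) (MP i.P)) ((nP i.P : ℕ) : ℂ) *ᵥ lam)) = 0 ∧
        QvOp (nP i.P) (MP i.P) *ᵥ (A' + GradOp (fine (nP i.P) (MP i.P)) ((nP i.P : ℕ) : ℂ) *ᵥ lam)
            = QvOp (nP i.P) (MP i.P) *ᵥ A' ∧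
        (∀ b, ‖(A' + GradOp (fine (nP i.P) (MP i.P)) ((nP i.P : ℕ) : ℂ) *ᵥ lam) b‖ ≤ B₁ * (α₀ + α₁)) ∧
        (∀ ν b, ‖grad (nP i.P) (MP i.P) (A' + GradOp (fine (nP i.P) (MP i.P)) ((nP i.P : ℕ) : ℂ) *ᵥ lam) ν b‖
            ≤ B₁ * (α₀ + α₁)) ∧
        (∀ b, ‖((1 / 2 : ℂ) • ((CurlOp (fine (nP i.P) (MP i.P)) ((nP i.P : ℕ) : ℂ))ᴴ *ᵥ
            (CurlOp (fine (nP i.P) (MP i.P)) ((nP i.P : ℕ) : ℂ) *ᵥ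
              (A' + GradOp (fine (nP i.P) (MP i.P)) ((nP i.P : ℕ) : ℂ) *ᵥ lam)))) b‖ ≤ B₁ * (α₀ + α₁)) ∧
        (∀ b, ‖(Lap (nP i.P) (MP i.P) *ᵥ (A' + GradOp (fine (nP i.P) (MP i.P)) ((nP i.P : ℕ) : ℂ) *ᵥ lam)) b‖
            ≤ B₁ * (α₀ + α₁)) ∧
        (∀ β₀ β : ℝ, 0 ≤ β₀ → β₀ < 1 → β ≤ β₀ →
          holderT (nP i.P) (MP i.P) β
              (grad (nP i.P) (MP i.P) (A' + GradOp (fine (nP i.P) (MP i.P)) ((nP i.P : ℕ) : ℂ) *ᵥ lam))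
            ≤ B₂ β₀ * (α₀ + α₁)) := by
  obtain ⟨B₁, B₂, hB₁, hB₂, h⟩ := thm4_flat_five hd hL
  refine ⟨B₁, B₂, hB₁, hB₂, fun i α₀ α₁ A' hα₀ hα₁ hJ hQ => ?_⟩
  obtain ⟨⟨lam, ⟨hQl, hLl⟩, huniq⟩, hall⟩ := h i α₀ α₁ A' hα₀ hα₁ hJ hQ
  obtain ⟨h37, hA, hg, hdd, hl, hh⟩ := hall lam hQl hLl
  exact ⟨lam, ⟨hQl, hLl, h37, hA, hg, hdd, hl, hh⟩, fun lam' h' => huniq lam' ⟨h'.1, h'.2.1⟩⟩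

end Main

/-! ## §6 The printed «(Lʲη)^{−2−β} on Ω_j, j = 0, 1, …, k» reading over the constant domain sequence -/

section Levels

/-- **The level form of the Hölder member over the constant domain sequence**: for `η = L^{−K}`, `L ≥ 1`, `j ≦ K` and `2 + β ≥ 0` the typed
p. 86 / (3.41) weight `(Lʲη)^{2+β} = B8ScaledSupNorm.weight L η (−2−β) j` is `≦ 1`, so a bound `h ≦ B` for the global seminorm `h = ‖A‖_{1,β} ≥ 0`
gives «‖A‖_{1,β} ≦ B·(Lʲη)^{−2−β} on Ω_j» for EVERY `j = 0, 1, …, k` in the form `(Lʲη)^{2+β}·‖A‖_{1,β} ≦ B`.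
[cite: Balaban1985RegularSpaces, (1.36) p.82 («on Ω_j, j = 0, 1, …, k»), p.86 (definition after (1.55)); Balaban1985BackgroundPropagators, (3.41) p.397] -/
theorem weight_holder_le {L K j : ℕ} (hL : 1 ≤ L) (hj : j ≤ K) {β h B : ℝ} (hβ : 0 ≤ 2 + β) (hh : 0 ≤ h) (hB : h ≤ B) :
    weight L (((L : ℝ) ^ K)⁻¹) (-2 - β) j * h ≤ B := by
  have hLr : (1 : ℝ) ≤ L := by exact_mod_cast hL
  have hLK : 0 < (L : ℝ) ^ K := pow_pos (by positivity) K
  have hη : 0 < ((L : ℝ) ^ K)⁻¹ := inv_pos.mpr hLK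
  have hw : weight L (((L : ℝ) ^ K)⁻¹) (-2 - β) j ≤ 1 := by
    unfold weight
    have e : (-(-2 - β) : ℝ) = 2 + β := by ring
    rw [e]
    refine Real.rpow_le_one (mul_nonneg (pow_nonneg (by positivity) j) hη.le) ?_ hβ
    rw [← div_eq_mul_inv, div_le_one hLK]
    exact pow_le_pow_right₀ hLr hj
  calc weight L (((L : ℝ) ^ K)⁻¹) (-2 - β) j * h ≤ 1 * h := mul_le_mul_of_nonneg_right hw hh
    _ = h := one_mul h
    _ ≤ B := hB

variable {L : ℕ}

/-- **(1.36), Hölder member, in the printed level form at U₀ = 1**: for the unique restricted Landau representative `A = A′ + ∂λ` of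
`thm2_flat_five` and every `0 ≦ β ≦ β₀ < 1`: `(Lʲη)^{2+β}·‖A‖_{1,β} ≦ B₂(β₀)(α₀ + α₁)` for EVERY `j = 0, 1, …, k` (η = L^{−K}, k = K; typed weight
`B8ScaledSupNorm.weight L η (−2−β) j`) — «‖A‖_{1,β} < B₂(β₀)(α₀ + α₁)(Lʲη)^{−2−β}, β ≦ β₀ < 1, on Ω_j, j = 0, 1, …, k» over the constant domain
sequence. [cite: Balaban1985RegularSpaces, (1.36) p.82, Thm 2 p.83, Prop. 3 p.87; Balaban1985BackgroundPropagators, (3.41) p.397] -/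
theorem thm2_flat_holder_levels (hd : 1 ≤ d) (hL : Odd L ∧ 1 < L) :
    ∃ B₂ : ℝ → ℝ, (∀ β₀, 1 ≤ B₂ β₀) ∧
      ∀ (i : TopIdx d L) (α₀ α₁ : ℝ) (A' : Tor (fine (nP i.P) (MP i.P)) × Fin i.P.d → ℂ),
      0 ≤ α₀ → 0 ≤ α₁ →
      (∀ b, ‖((1 / 2 : ℂ) • ((CurlOp (fine (nP i.P) (MP i.P)) ((nP i.P : ℕ) : ℂ))ᴴ *ᵥ
          (CurlOp (fine (nP i.P) (MP i.P)) ((nP i.P : ℕ) : ℂ) *ᵥ A'))) b‖ ≤ 2 * α₀) →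
      (∀ c, ‖(QvOp (nP i.P) (MP i.P) *ᵥ A') c‖ ≤ 2 * d * L * α₁) →
      ∀ lam : Tor (fine (nP i.P) (MP i.P)) → ℂ, QsOp (nP i.P) (MP i.P) *ᵥ lam = 0 →
        RT (nP i.P) (MP i.P) *ᵥ ((GradOp (fine (nP i.P) (MP i.P)) ((nP i.P : ℕ) : ℂ))ᴴ *ᵥ
          (A' + GradOp (fine (nP i.P) (MP i.P)) ((nP i.P : ℕ) : ℂ) *ᵥ lam)) = 0 →
        ∀ β₀ β : ℝ, 0 ≤ β₀ → β₀ < 1 → 0 ≤ β → β ≤ β₀ → ∀ j, j ≤ i.P.K →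
          weight L (((L : ℝ) ^ i.P.K)⁻¹) (-2 - β) j *
              holderT (nP i.P) (MP i.P) β
                (grad (nP i.P) (MP i.P) (A' + GradOp (fine (nP i.P) (MP i.P)) ((nP i.P : ℕ) : ℂ) *ᵥ lam))
            ≤ B₂ β₀ * (α₀ + α₁) := by
  obtain ⟨B₁, B₂, hB₁, hB₂, h⟩ := thm4_flat_five hd hL
  refine ⟨B₂, hB₂, fun i α₀ α₁ A' hα₀ hα₁ hJ hQ lam hlam hLan β₀ β hβ₀0 hβ₀1 hβ0 hββ₀ j hj => ?_⟩
  obtain ⟨-, hall⟩ := h i α₀ α₁ A' hα₀ hα₁ hJ hQ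
  have hh := (hall lam hlam hLan).2.2.2.2.2 β₀ β hβ₀0 hβ₀1 hββ₀
  exact weight_holder_le hL.2.le hj (by linarith) (holderT_nonneg _ _) hh

end Levels

end Literature.MathematicalPhysics.QuantumFieldTheory.Balaban1983to89.B8Eq136HolderFlatTorus

end
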